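import Summits.QuantumAdvantage.QuantumAdvantage.Theorems.ArithStatLadderDigitRungStubFundWeylAux
import Summits.QuantumAdvantage.QuantumAdvantage.Theorems.ArithStatLadderDigitRungStubHigh
import Mathlib.Analysis.SpecificLimits.Normed

/-!
# `DigitRung` (stmt-QuantumAdvantage-15008, ex 2423), line `Sketch` — stub `stub_fundWeyl`

The unweighted Weyl sums over the block `𝒟_n` (the `n`-bit `d` with `−d` fundamental) at the dyadic
frequencies `r/2^k`, `r` odd, `5 ≤ k ≤ 7n/10 + 1`:
`k · ‖Σ_{d ∈ 𝒟_n} e(d r/2^k)‖ ≤ ε · #𝒟_n` eventually in `n`.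

Proof (elementary, all inputs proved in the tree):
* `sum_block_eq_sub` — `Σ_{d ∈ 𝒟_n} f(−d) = T(2^n) − T(2^{n−1})`, `T(X) = Σ_{D ∈ negFundDiscrs X} f(D)`
  (the reindexing `StubHigh.sum_eq_sub_of_mem_iff`, made complex-valued);
* `sum_negFundDiscrs_eq` — sorting `negFundDiscrs X` by residues mod `4`
  (`negFundDiscrs_eq_union`): `T(X) = S₃(X−1; x) + S₂(⌊(X−1)/4⌋; 4x) + S₁(⌊(X−1)/4⌋; 4x)` with the
  squarefree class sums `S_c(M; y) = Σ_{m ≤ M, m ≡ c (4), m sqfree} e(m y)` (kept as explicit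
  expressions, no definition);
* each `S_c` is bounded by `StubFundWeyl.norm_sum_squarefree_mod_four_le` (Möbius inversion +
  geometric sums): `‖S_c‖ ≤ A·2^k/2 + (M+1)/A` as soon as `2^k‖4a²y‖ ≥ 1` for all odd `a`, which
  holds at `y = r/2^k` and `y = r/2^{k−2}` for `k ≥ 5` (`one_le_two_pow_mul_distInt_phase`);
* with `A = 2^{⌊n/10⌋}` and `10k ≤ 7n + 10`: `‖Σ‖ ≤ 12 · 2^{n − ⌊n/10⌋}`, and
  `192 n ≤ ε 2^{⌊n/10⌋}` eventually, against `2^n ≤ 16 #𝒟_n` (`two_pow_le_card_block`).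
-/

noncomputable section

namespace Summit.QuantumAdvantage.DigitRung.Sketch

open scoped Classical FourierTransform
open Filter Finset
open Literature.NumberTheory.QuadraticFields
open Literature.NumberTheory.Sieve.Vinogradov
open Summit.QuantumAdvantage.DigitRung.Negative

namespace StubFundWeyl

/-! ### From the block to `negFundDiscrs`, and sorting by residues mod `4` -/

/-- Complex-valued form of the reindexing `d ↦ −d`:
`Σ_{d ∈ 𝒟_n} f(−d) = Σ_{negFundDiscrs 2^n} f − Σ_{negFundDiscrs 2^{n−1}} f`. [folklore] -/
theorem sum_block_eq_sub (n : ℕ) (f : ℤ → ℂ) :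
    ∑ d ∈ block n, f (-(d : ℤ)) =
      (∑ D ∈ negFundDiscrs (2 ^ n), f D) - ∑ D ∈ negFundDiscrs (2 ^ (n - 1)), f D := by
  have hpow : 2 ^ (n - 1) ≤ 2 ^ n := Nat.pow_le_pow_right two_pos (Nat.sub_le n 1)
  have hre := StubHigh.sum_eq_sub_of_mem_iff hpow (s := block n) (fun d => mem_block)
    (fun D => (f D).re)
  have him := StubHigh.sum_eq_sub_of_mem_iff hpow (s := block n) (fun d => mem_block)
    (fun D => (f D).im)
  apply Complex.ext
  · simpa [Complex.re_sum] using hre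
  · simpa [Complex.im_sum] using him

/-- `(Ioc 0 M).filter (sqfree ∧ ≡ c)` is `(range (M+1)).filter (≡ c ∧ sqfree)` for `c ≠ 0`.
[folklore] -/
theorem filter_Ioc_eq_filter_range {c : ℕ} (hc : c ≠ 0) (M : ℕ) :
    (Ioc 0 M).filter (fun m => Squarefree m ∧ m % 4 = c) =
      (range (M + 1)).filter (fun m => m % 4 = c ∧ Squarefree m) := by
  ext m
  simp only [mem_filter, mem_Ioc, mem_range]
  constructor
  · rintro ⟨⟨h0, hM⟩, hsq, hmc⟩
    exact ⟨by omega, hmc, hsq⟩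
  · rintro ⟨hM, hmc, hsq⟩
    have : m ≠ 0 := by rintro rfl; simp at hmc; exact hc hmc.symm
    exact ⟨⟨by omega, by omega⟩, hsq, hmc⟩

/-- **Sorting by residues mod `4`.** With `f(D) = e(−D·x)`:
`Σ_{D ∈ negFundDiscrs X} e(−D x) = S₃(X−1; x) + S₂(⌊(X−1)/4⌋; 4x) + S₁(⌊(X−1)/4⌋; 4x)`. [folklore] -/
theorem sum_negFundDiscrs_eq (X : ℕ) (x : ℝ) :
    ∑ D ∈ negFundDiscrs X, (𝐞 (-(D : ℝ) * x) : ℂ) =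
      (∑ m ∈ (range (X - 1 + 1)).filter (fun m => m % 4 = 3 ∧ Squarefree m),
          (𝐞 ((m : ℝ) * (x)) : ℂ)) + (∑ m ∈ (range ((X - 1) / 4 + 1)).filter (fun m => m % 4 = 2 ∧ Squarefree m),
          (𝐞 ((m : ℝ) * (4 * x)) : ℂ)) +
        (∑ m ∈ (range ((X - 1) / 4 + 1)).filter (fun m => m % 4 = 1 ∧ Squarefree m),
          (𝐞 ((m : ℝ) * (4 * x)) : ℂ)) := by
  set M : ℕ := (X - 1) / 4 with hM
  have hsplit : (Ioc 0 M).filter (fun n => Squarefree n ∧ (n % 4 = 2 ∨ n % 4 = 1)) =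
      (Ioc 0 M).filter (fun n => Squarefree n ∧ n % 4 = 2) ∪
        (Ioc 0 M).filter (fun n => Squarefree n ∧ n % 4 = 1) := by
    ext m; simp only [mem_filter, mem_union]; tauto
  have hdisj : Disjoint ((Ioc 0 M).filter (fun n => Squarefree n ∧ n % 4 = 2))
      ((Ioc 0 M).filter (fun n => Squarefree n ∧ n % 4 = 1)) := by
    rw [Finset.disjoint_left]
    intro m h2 h1
    rw [mem_filter] at h2 h1
    omega
  have e1 : ∀ m : ℕ, -(((-(m : ℤ) : ℤ)) : ℝ) * x = (m : ℝ) * x := by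
    intro m; push_cast; ring
  have e4 : ∀ m : ℕ, -(((4 * -(m : ℤ) : ℤ)) : ℝ) * x = (m : ℝ) * (4 * x) := by
    intro m; push_cast; ring
  rw [negFundDiscrs_eq_union X, Finset.sum_union]
  · rw [Finset.sum_map, Finset.sum_map]
    simp only [Function.Embedding.coeFn_mk, e1, e4]
    rw [add_assoc, ← hM, hsplit, Finset.sum_union hdisj,
      ← filter_Ioc_eq_filter_range (by norm_num : (3 : ℕ) ≠ 0),
      ← filter_Ioc_eq_filter_range (by norm_num : (2 : ℕ) ≠ 0),
      ← filter_Ioc_eq_filter_range (by norm_num : (1 : ℕ) ≠ 0)]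
  · rw [Finset.disjoint_left]
    rintro D h1 h4
    simp only [Finset.mem_map, mem_filter, Function.Embedding.coeFn_mk] at h1 h4
    obtain ⟨n, ⟨-, -, hn3⟩, rfl⟩ := h1
    obtain ⟨m, -, hm⟩ := h4
    omega

/-- The Weyl sum over the block as a signed combination of six squarefree class sums. [folklore] -/
theorem norm_sum_block_le (n : ℕ) (x : ℝ) :
    ‖∑ d ∈ block n, (𝐞 ((d : ℝ) * x) : ℂ)‖ ≤
      (‖(∑ m ∈ (range (2 ^ n - 1 + 1)).filter (fun m => m % 4 = 3 ∧ Squarefree m),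
          (𝐞 ((m : ℝ) * (x)) : ℂ))‖ + ‖(∑ m ∈ (range ((2 ^ n - 1) / 4 + 1)).filter (fun m => m % 4 = 2 ∧ Squarefree m),
          (𝐞 ((m : ℝ) * (4 * x)) : ℂ))‖ +
        ‖(∑ m ∈ (range ((2 ^ n - 1) / 4 + 1)).filter (fun m => m % 4 = 1 ∧ Squarefree m),
          (𝐞 ((m : ℝ) * (4 * x)) : ℂ))‖) +
      (‖(∑ m ∈ (range (2 ^ (n - 1) - 1 + 1)).filter (fun m => m % 4 = 3 ∧ Squarefree m),
          (𝐞 ((m : ℝ) * (x)) : ℂ))‖ + ‖(∑ m ∈ (range ((2 ^ (n - 1) - 1) / 4 + 1)).filter (fun m => m % 4 = 2 ∧ Squarefree m),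
          (𝐞 ((m : ℝ) * (4 * x)) : ℂ))‖ +
        ‖(∑ m ∈ (range ((2 ^ (n - 1) - 1) / 4 + 1)).filter (fun m => m % 4 = 1 ∧ Squarefree m),
          (𝐞 ((m : ℝ) * (4 * x)) : ℂ))‖) := by
  have h := sum_block_eq_sub n (fun D => (𝐞 (-(D : ℝ) * x) : ℂ))
  simp only [Int.cast_neg, Int.cast_natCast, neg_neg] at h
  rw [h, sum_negFundDiscrs_eq, sum_negFundDiscrs_eq]
  calc _ ≤ ‖(∑ m ∈ (range (2 ^ n - 1 + 1)).filter (fun m => m % 4 = 3 ∧ Squarefree m),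
          (𝐞 ((m : ℝ) * (x)) : ℂ)) + (∑ m ∈ (range ((2 ^ n - 1) / 4 + 1)).filter (fun m => m % 4 = 2 ∧ Squarefree m),
          (𝐞 ((m : ℝ) * (4 * x)) : ℂ)) +
          (∑ m ∈ (range ((2 ^ n - 1) / 4 + 1)).filter (fun m => m % 4 = 1 ∧ Squarefree m),
          (𝐞 ((m : ℝ) * (4 * x)) : ℂ))‖ +
        ‖(∑ m ∈ (range (2 ^ (n - 1) - 1 + 1)).filter (fun m => m % 4 = 3 ∧ Squarefree m),
          (𝐞 ((m : ℝ) * (x)) : ℂ)) + (∑ m ∈ (range ((2 ^ (n - 1) - 1) / 4 + 1)).filter (fun m => m % 4 = 2 ∧ Squarefree m),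
          (𝐞 ((m : ℝ) * (4 * x)) : ℂ)) +
          (∑ m ∈ (range ((2 ^ (n - 1) - 1) / 4 + 1)).filter (fun m => m % 4 = 1 ∧ Squarefree m),
          (𝐞 ((m : ℝ) * (4 * x)) : ℂ))‖ := norm_sub_le _ _
    _ ≤ _ := by gcongr <;> exact norm_add₃_le

/-! ### Bounding one class sum at a dyadic frequency -/

/-- At `y = r/2^j` with `r` odd and `3 ≤ j ≤ k`: `‖S_c(M; y)‖ ≤ A·2^k/2 + (M+1)/A` for every
`A ≥ 1` and `c ∈ {1,2,3}`. [folklore] -/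
theorem norm_classSum_le {c : ℕ} (hc0 : c ≠ 0) (hc4 : c < 4) (M : ℕ) {r j k : ℕ} (hr : Odd r)
    (hj : 3 ≤ j) (hjk : j ≤ k) {A : ℕ} (hA : 1 ≤ A) :
    ‖(∑ m ∈ (range (M + 1)).filter (fun m => m % 4 = c ∧ Squarefree m),
          (𝐞 ((m : ℝ) * ((r : ℝ) / 2 ^ j)) : ℂ))‖ ≤ (A : ℝ) * 2 ^ k / 2 + ((M + 1 : ℕ) : ℝ) / A := by
  exact norm_sum_squarefree_mod_four_le hc0 hc4 (M + 1) _
    (fun a ha => one_le_two_pow_mul_distInt_phase ha hr hj hjk) hA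

/-- The three class sums of one `T(X)` at the depth `k ≥ 5`, `X ≤ 2^n`, are each
`≤ A·2^k/2 + 2^n/A`. [folklore] -/
theorem norm_three_classSum_le {X n k r : ℕ} (hX : X ≤ 2 ^ n) (hk : 5 ≤ k) (hr : Odd r) {A : ℕ}
    (hA : 1 ≤ A) :
    ‖(∑ m ∈ (range (X - 1 + 1)).filter (fun m => m % 4 = 3 ∧ Squarefree m),
          (𝐞 ((m : ℝ) * ((r : ℝ) / 2 ^ k)) : ℂ))‖ + ‖(∑ m ∈ (range ((X - 1) / 4 + 1)).filter (fun m => m % 4 = 2 ∧ Squarefree m),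
          (𝐞 ((m : ℝ) * (4 * ((r : ℝ) / 2 ^ k))) : ℂ))‖ +
        ‖(∑ m ∈ (range ((X - 1) / 4 + 1)).filter (fun m => m % 4 = 1 ∧ Squarefree m),
          (𝐞 ((m : ℝ) * (4 * ((r : ℝ) / 2 ^ k))) : ℂ))‖ ≤
      3 * ((A : ℝ) * 2 ^ k / 2 + (2 : ℝ) ^ n / A) := by
  have hA0 : (0 : ℝ) < A := by exact_mod_cast hA
  have h4x : (4 : ℝ) * ((r : ℝ) / 2 ^ k) = (r : ℝ) / 2 ^ (k - 2) := by
    obtain ⟨m, rfl⟩ : ∃ m, k = m + 2 := ⟨k - 2, by omega⟩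
    rw [Nat.add_sub_cancel, pow_add]
    field_simp
    ring
  rw [h4x]
  have h2n : 1 ≤ 2 ^ n := Nat.one_le_two_pow
  have hM1 : ((X - 1 + 1 : ℕ) : ℝ) ≤ (2 : ℝ) ^ n := by
    have : X - 1 + 1 ≤ 2 ^ n := by omega
    exact_mod_cast this
  have hM2 : (((X - 1) / 4 + 1 : ℕ) : ℝ) ≤ (2 : ℝ) ^ n := by
    have : (X - 1) / 4 + 1 ≤ 2 ^ n := by omega
    exact_mod_cast this
  have h3 := norm_classSum_le (by norm_num : (3:ℕ) ≠ 0) (by norm_num) (X - 1) hr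
    (by omega : 3 ≤ k) le_rfl hA
  have h2 := norm_classSum_le (by norm_num : (2:ℕ) ≠ 0) (by norm_num) ((X - 1) / 4) hr
    (by omega : 3 ≤ k - 2) (by omega : k - 2 ≤ k) hA
  have h1 := norm_classSum_le (by norm_num : (1:ℕ) ≠ 0) (by norm_num) ((X - 1) / 4) hr
    (by omega : 3 ≤ k - 2) (by omega : k - 2 ≤ k) hA
  have e1 : ((X - 1 + 1 : ℕ) : ℝ) / A ≤ (2 : ℝ) ^ n / A := div_le_div_of_nonneg_right hM1 hA0.le
  have e2 : (((X - 1) / 4 + 1 : ℕ) : ℝ) / A ≤ (2 : ℝ) ^ n / A :=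
    div_le_div_of_nonneg_right hM2 hA0.le
  linarith

/-- **The block Weyl sum at depth `k`**: for `5 ≤ k`, odd `r`, `A ≥ 1`:
`‖Σ_{d ∈ 𝒟_n} e(d r/2^k)‖ ≤ 6 (A 2^k/2 + 2^n/A)`. [folklore] -/
theorem norm_sum_block_le_of_depth {n k r : ℕ} (hk : 5 ≤ k) (hr : Odd r) {A : ℕ} (hA : 1 ≤ A) :
    ‖∑ d ∈ block n, (𝐞 ((d : ℝ) * ((r : ℝ) / 2 ^ k)) : ℂ)‖ ≤
      6 * ((A : ℝ) * 2 ^ k / 2 + (2 : ℝ) ^ n / A) := by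
  have hX1 : 2 ^ n ≤ 2 ^ n := le_rfl
  have hX2 : 2 ^ (n - 1) ≤ 2 ^ n := Nat.pow_le_pow_right two_pos (Nat.sub_le n 1)
  have h1 := norm_three_classSum_le hX1 hk hr hA
  have h2 := norm_three_classSum_le hX2 hk hr hA
  have h := norm_sum_block_le n ((r : ℝ) / 2 ^ k)
  linarith

/-! ### The eventual inequality -/

/-- `1920 (q + 1) ≤ ε 2^q` eventually in `q`. [folklore] -/
theorem eventually_linear_le_two_pow {ε : ℝ} (hε : 0 < ε) :
    ∀ᶠ q : ℕ in atTop, 1920 * ((q : ℝ) + 1) ≤ ε * 2 ^ q := by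
  have ht : Tendsto (fun q : ℕ => (q : ℝ) ^ 1 / 2 ^ q) atTop (nhds 0) :=
    tendsto_pow_const_div_const_pow_of_one_lt 1 one_lt_two
  have hev := ht.eventually (gt_mem_nhds (show (0 : ℝ) < ε / 3840 by positivity))
  filter_upwards [hev, eventually_ge_atTop 1] with q hq hq1
  rw [pow_one, div_lt_iff₀ (by positivity)] at hq
  have hq1' : (1 : ℝ) ≤ q := by exact_mod_cast hq1
  nlinarith [pow_pos (two_pos : (0:ℝ) < 2) q]

/-- From `q = ⌊n/10⌋` eventualities to `n` eventualities. [folklore] -/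
theorem eventually_of_div_ten {P : ℕ → Prop} (h : ∀ᶠ q : ℕ in atTop, P q) :
    ∀ᶠ n : ℕ in atTop, P (n / 10) := by
  rw [Filter.eventually_atTop] at h ⊢
  obtain ⟨Q, hQ⟩ := h
  exact ⟨10 * Q, fun n hn => hQ _ ((Nat.le_div_iff_mul_le (by norm_num)).mpr (by omega))⟩

end StubFundWeyl

open StubFundWeyl in
/-- **Stub (unweighted Weyl sums over fundamental discriminants, depths `5 ≤ k ≤ 7n/10 + 1`).**
`k·‖Σ_{d ∈ 𝒟_n} e(d r/2^k)‖ ≤ ε·#𝒟_n` for odd `r`, eventually in `n`: the block sum is a signed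
combination of six squarefree class sums mod `4` (`norm_sum_block_le`), each bounded through Möbius
inversion and geometric sums by `A·2^k/2 + 2^n/A` (`norm_sum_squarefree_mod_four_le`; the step
phases `4a²r/2^k`, `a` odd, stay `≥ 2^{-k}` away from `ℤ`); with `A = 2^{⌊n/10⌋}` and
`10k ≤ 7n + 10` this is `≤ 12·2^{n−⌊n/10⌋}`, while `#𝒟_n ≥ 2^n/16`. [folklore] -/
theorem stub_fundWeyl :
    ∀ ε : ℝ, 0 < ε → ∀ᶠ n : ℕ in atTop, ∀ k r : ℕ, 5 ≤ k → 10 * k ≤ 7 * n + 10 → Odd r →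
      r < 2 ^ k →
      (k : ℝ) * ‖∑ d ∈ block n, (𝐞 ((d : ℝ) * ((r : ℝ) / 2 ^ k)) : ℂ)‖ ≤ ε * ((block n).card : ℝ) := by
  intro ε hε
  filter_upwards [eventually_of_div_ten (eventually_linear_le_two_pow hε),
    eventually_ge_atTop 16] with n hq hn16 k r hk hkn hr _hr
  set q : ℕ := n / 10 with hqdef
  have hq10 : 10 * q ≤ n := Nat.mul_div_le n 10
  have hnq : n < 10 * (q + 1) := by omega
  have hkn' : k ≤ n := by omega
  have h2qk : 2 * q + k ≤ n + 1 := by omega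
  -- the Weyl bound with `A = 2^q`
  have hA : 1 ≤ 2 ^ q := Nat.one_le_two_pow
  have hW := norm_sum_block_le_of_depth (n := n) hk hr hA
  push_cast at hW
  -- `2^q · 2^k / 2 ≤ 2^n / 2^q` from `2q + k ≤ n + 1`
  have hpow1 : (2 : ℝ) ^ q * 2 ^ k / 2 ≤ 2 ^ n / 2 ^ q := by
    rw [div_le_div_iff₀ (by positivity) (by positivity)]
    calc (2 : ℝ) ^ q * 2 ^ k * 2 ^ q = 2 ^ (2 * q + k) := by rw [← pow_add, ← pow_add]; ring_nf
      _ ≤ 2 ^ (n + 1) := pow_le_pow_right₀ (by norm_num) h2qk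
      _ = 2 ^ n * 2 := pow_succ 2 n
  have hW' : ‖∑ d ∈ block n, (𝐞 ((d : ℝ) * ((r : ℝ) / 2 ^ k)) : ℂ)‖ ≤ 12 * (2 ^ n / 2 ^ q) := by
    linarith
  -- the block is large and `192 n ≤ ε 2^q`
  have hcard := two_pow_le_card_block n hn16
  have hkR : (k : ℝ) ≤ n := by exact_mod_cast hkn'
  have hnR : (n : ℝ) ≤ 10 * ((q : ℝ) + 1) := by exact_mod_cast (by omega : n ≤ 10 * (q + 1))
  have h2q : (0 : ℝ) < 2 ^ q := by positivity
  have h2n : (0 : ℝ) < 2 ^ n := by positivity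
  have hk0 : (0 : ℝ) ≤ k := Nat.cast_nonneg _
  calc (k : ℝ) * ‖∑ d ∈ block n, (𝐞 ((d : ℝ) * ((r : ℝ) / 2 ^ k)) : ℂ)‖
      ≤ (n : ℝ) * (12 * (2 ^ n / 2 ^ q)) := mul_le_mul hkR hW' (norm_nonneg _) (Nat.cast_nonneg _)
    _ = (12 * n / 2 ^ q) * 2 ^ n := by field_simp
    _ ≤ (ε / 16) * 2 ^ n := by
        apply mul_le_mul_of_nonneg_right _ h2n.le
        rw [div_le_iff₀ h2q]
        nlinarith
    _ ≤ ε * ((block n).card : ℝ) := by nlinarith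

end Summit.QuantumAdvantage.DigitRung.Sketch

end
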